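import Mathlib.Algebra.CharP.Two
import Mathlib.Analysis.Asymptotics.Defs
import Mathlib.Data.ZMod.Basic
import Mathlib.Data.Multiset.Bind
import Mathlib.Data.Set.Card
import Mathlib.Data.Real.Basic
import Mathlib.Data.Fintype.Prod
import Mathlib.Logic.Equiv.Prod
import Mathlib.Order.Filter.AtTopBot.Basic
import Mathlib.Tactic.LinearCombination
import Mathlib.Tactic.Linarith
import Literature.ModelTheory.FiniteModelTheory.StructCkEquiv
import HarnessLib

/-!
# Atserias–Dawar 2019: satisfiable vs. far-from-satisfiable 3XOR instances are `C^k`-inseparable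

Topic `Literature/ModelTheory/FiniteModelTheory`; cite item `wi-10497` (route PneNP/PhaseTwins,
cruxes `PolyDepthTwinsAbove` / `MacroscopicTwinsAbove`, which start from these "3XOR gap twins").
Source: A. Atserias, A. Dawar, *Definable inapproximability: new challenges for duplicator*,
J. Logic Comput. 29 (2019), arXiv:1806.11307 — §2.1, §3 (numbering of the arXiv version:
Lemma 2 = `lem:CFI`, Lemma 3 = `lem:both-lift`, Lemma 4 = `lem:both-extremal`, Lemma 5 =
`lem:linear-local-bound`, Theorem 8 = `thm:3lin-onesided`).

## Contents

1. 3XOR INSTANCES (`Xor3.Instance V`): finite MULTISETS of equations `x + y + z = b` over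
   `𝔽₂ = ZMod 2` (§3.1: "a collection (multi-set) of constraints"); `IsSat`; `IsCSat c`
   (`c`-SATISFIABLE: some assignment satisfies at least `c·m` of the `m` equations, with
   multiplicity); `WellFormed` (three distinct variables per equation). As a finite relational
   STRUCTURE an instance is read in the paper's SECOND ENCODING (§3.1): universe `V`, ternary
   relations `R_b` (`b ∈ 𝔽₂`), `R_b(x,y,z)` iff `x + y + z = b` is one of the equations
   (`Instance.Rel`; multiplicity is invisible to the structure, as the paper notes).
2. The DOUBLING `G(I)` (§3.2, `Instance.double`): variables `x⁰, x¹` (`V × 𝔽₂`) and, for each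
   equation `x + y + z = b` of `I`, the eight equations `x^{a₁} + y^{a₂} + z^{a₃} = b + a₁ + a₂ + a₃`;
   the HOMOGENEOUS COMPANION `I⁰` (`Instance.homog`, all right-hand sides `0`). PROVED:
   `mem_double`, `mem_homog`, `card_double` (`8m` equations), `IsSat.double` (Lemma 3(1) at
   `c = 1`), `isSat_homog_double` (`G(I⁰)` is always satisfiable, §3.2).
3. GAMES (§2.1), in the back-and-forth-system form of the tree's `CkEquiv.lean` (graphs; same
   field names): `Xor3.IsPartialIso`, `Xor3.BijPebbleStrategy k I J`, `Xor3.CkEquiv k I J` —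
   Duplicator wins Hella's BIJECTIVE `k`-pebble game on the two encoding structures, i.e.
   `I ≡_{C^k} J` [Hel96 as quoted in §2.1] (API `zero`, `mono`, `symm`, `nonempty_equiv`,
   `card_eq`, proved). The encoding structure is also given as a Mathlib `L`-structure
   (`Xor3.language` = two ternary symbols `R₀, R₁`; `Instance.structure`), and the PROVED bridge
   `Xor3.ckEquiv_iff_structCkEquiv` identifies `Xor3.CkEquiv k I J` with the tree's game on
   arbitrary relational structures, `StructCkEquiv Xor3.language k` (`StructCkEquiv.lean`,
   labelled pebbles) — so everything below can be consumed over `StructCkEquiv` (e.g. by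
   FO-interpretation transfers). Further: `Xor3.LocalSatStrategy k I`, `Instance.IsLocallySat k I` — Duplicator
   wins the EXISTENTIAL `k`-pebble game [KV90] on `I` and the template `Γ_3XOR` (universe `𝔽₂`,
   `R_b = {u+v+w = b}`), i.e. `I` is `k`-LOCALLY SATISFIABLE (§3.1). PROVED:
   `IsLocallySat.isSat` / `card_lt` (an unsatisfiable `k`-locally satisfiable instance has more
   than `k` variables), `mono`.
4. LEMMA 2, PROVED (`IsLocallySat.ckEquiv_double`): `I` `k`-locally satisfiable ⇒
   `G(I) ≡_{C^k} G(I⁰)` — the printed Duplicator strategy (pebble `x^a` against `x^{a+v}`, `v` her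
   existential answer; announce the bijection `x^a ↦ x^{a+f(x)}`); the printed hypothesis `k ≥ 3`
   is not needed.
5. The NAMED FACT `AtseriasDawar2019_xorLocalGap` = the sentence opening the printed proof of
   Theorem 8 ("by combining Lemma 5 with Lemma 4 there is a family `(S_k)_{k≥1}` with `O(k)`
   variables and equations such that `G(S_k)` is not `(1/2+ε)`-satisfiable but `S_k` is
   `k`-locally satisfiable"): the expander/probabilistic input (unique-neighbour expanders,
   Ben-Sasson–Wigderson width, Atserias–Dalmau, Hoeffding), not proved here.
6. THEOREM 8, DERIVED from the fact: `AtseriasDawar2019_thm8_family` (for every `k ≥ 1`, twins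
   `I⁰_k = G(S_k⁰) ≡_{C^k} I¹_k = G(S_k)` on `2n ≤ 2ck` variables, `I⁰_k` satisfiable, `I¹_k` not
   `(1/2+ε)`-satisfiable, and `k < n`) and `AtseriasDawar2019_thm8` (the printed form: for every
   `k(n) = o(n)` the two classes are not `C^k`-separable — unfolded with the definition of
   separability of §2.1 over structures with at most `N` elements, here for all large `N`).

SCOPE CAVEATS. (a) The source's instances are left-3-regular systems `Ax = b` (three ones per
row); it does NOT bound the number of occurrences of a variable (the expanders of Lemma 5 are
only left-regular), and nothing of the kind is asserted here — a bounded-occurrence / bounded-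
degree version, if a route needs it, is a different statement. (b) Transfers to 3SAT, MAX-CUT,
vertex cover / independent set (Thm 9, §5.1, Lemma 1 on FO-interpretations) are NOT here: they
need a Lean notion of FO-interpretation first (cf. the note in `CkEquiv.lean`). (c) The logics
`C^k`, `∃L^k` themselves are not formalised; the game characterisations [Hel96, KV90] quoted in
§2.1 are taken as the definitions, as in `CkEquiv.lean`.

## References
* [AtseriasDawar2019] as above. Read: the arXiv TeX via `lit read arxiv:1806.11307`, chunks
  5–13 and 19 (§2.1–2.2, §3.1–3.2 with Lemmas 2–5, Claims 6–7, Thm 8–9, Cor 10; §5.1).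
* [Hel96] L. Hella, *Logical hierarchies in PTIME*, Inform. Comput. 129 (1996) 1–19 (bijective
  game); [KV90] Ph. G. Kolaitis, M. Y. Vardi, *On the expressive power of Datalog: tools and a
  case study*, PODS 1990 / JCSS 51 (1995) (existential pebble game) — both as quoted in AD19 §2.1.
-/

namespace Literature.ModelTheory.FiniteModelTheory

open FirstOrder FirstOrder.Language.Structure

namespace Xor3

variable {V α β : Type*}

/-! ### Instances, satisfiability, the encoding structure -/

/-- An equation `x + y + z = b` over `𝔽₂`, as the tuple `(x, y, z, b)`.
[cite: AtseriasDawar2019, §3.1] -/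
abbrev Equation (V : Type*) := V × V × V × ZMod 2

/-- A 3XOR instance over the variable set `V`: a finite multiset of equations `x + y + z = b`
("collection (multi-set) of constraints"). [cite: AtseriasDawar2019, §3.1] -/
abbrev Instance (V : Type*) := Multiset (Equation V)

namespace Equation

/-- The assignment `f : V → 𝔽₂` satisfies the equation `x + y + z = b`.
[cite: AtseriasDawar2019, §3.1] -/
def IsSatBy (f : V → ZMod 2) (e : Equation V) : Prop :=
  f e.1 + f e.2.1 + f e.2.2.1 = e.2.2.2

/-- Satisfaction of an equation is decidable. [folklore] -/
instance (f : V → ZMod 2) (e : Equation V) : Decidable (e.IsSatBy f) :=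
  inferInstanceAs (Decidable (_ = _))

/-- The three variables of the equation are pairwise distinct ("parities of three distinct
variables"). [cite: AtseriasDawar2019, §3 (intro) and §3.1] -/
def VarsDistinct (e : Equation V) : Prop :=
  e.1 ≠ e.2.1 ∧ e.1 ≠ e.2.2.1 ∧ e.2.1 ≠ e.2.2.1

/-- Distinctness of the variables is decidable. [folklore] -/
instance [DecidableEq V] (e : Equation V) : Decidable e.VarsDistinct :=
  inferInstanceAs (Decidable (_ ∧ _ ∧ _))

/-- The eight equations `x^{a₁} + y^{a₂} + z^{a₃} = b + a₁ + a₂ + a₃` of `G(I)` arising from one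
equation `x + y + z = b`. [cite: AtseriasDawar2019, §3.2] -/
def double (e : Equation V) : Instance (V × ZMod 2) :=
  (Finset.univ : Finset (ZMod 2 × ZMod 2 × ZMod 2)).val.map fun a =>
    ((e.1, a.1), (e.2.1, a.2.1), (e.2.2.1, a.2.2), e.2.2.2 + a.1 + a.2.1 + a.2.2)

/-- Each equation gives exactly eight equations of `G(I)`. [cite: AtseriasDawar2019, §3.2] -/
theorem card_double (e : Equation V) : Multiset.card e.double = 8 := by
  simp [double]

end Equation

namespace Instance

/-- The number of equations of `I` (with multiplicity) satisfied by `f`.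
[cite: AtseriasDawar2019, §3.1] -/
def satCount (I : Instance V) (f : V → ZMod 2) : ℕ :=
  I.countP fun e => e.IsSatBy f

/-- `I` is satisfiable: some assignment satisfies every equation. [cite: AtseriasDawar2019, §3.1] -/
def IsSat (I : Instance V) : Prop :=
  ∃ f : V → ZMod 2, ∀ e ∈ I, e.IsSatBy f

/-- `I` is `c`-SATISFIABLE: some assignment satisfies at least `c·m` of the `m` equations of `I`,
counted with multiplicity. [cite: AtseriasDawar2019, §3.1] -/
def IsCSat (c : ℝ) (I : Instance V) : Prop :=
  ∃ f : V → ZMod 2, c * (Multiset.card I : ℝ) ≤ (I.satCount f : ℝ)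

/-- Every equation of `I` is on three distinct variables. [cite: AtseriasDawar2019, §3.1] -/
def WellFormed (I : Instance V) : Prop :=
  ∀ e ∈ I, e.VarsDistinct

/-- Well-formedness is decidable. [folklore] -/
instance [DecidableEq V] (I : Instance V) : Decidable I.WellFormed :=
  inferInstanceAs (Decidable (∀ e ∈ I, e.VarsDistinct))

/-- The SECOND ENCODING of `I` as a finite structure: universe `V` and, for `b ∈ 𝔽₂`, the ternary
relation `R_b(x, y, z)` iff `x + y + z = b` is one of the equations of `I` (multiplicity is
invisible). The relation records the ORDERED triple as written in the instance; this is a finer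
encoding than a symmetric reading of `x + y + z = b` (partial isomorphisms must respect the
order), so `≡_{C^k}` for this encoding implies `≡_{C^k}` for the symmetrised one, and the named
fact below does not depend on the choice. [cite: AtseriasDawar2019, §3.1 (second encoding)] -/
def Rel (I : Instance V) (b : ZMod 2) (x y z : V) : Prop :=
  (x, y, z, b) ∈ I

/-- The HOMOGENEOUS COMPANION `I⁰` of `I = (Ax = b)`: the system `Ax = 0`.
[cite: AtseriasDawar2019, §3.2] -/
def homog (I : Instance V) : Instance V :=
  I.map fun e => (e.1, e.2.1, e.2.2.1, 0)

/-- The DOUBLING `G(I)`: variables `x⁰, x¹` (`V × 𝔽₂`) and, for each equation `x + y + z = b` of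
`I`, the eight equations `x^{a₁} + y^{a₂} + z^{a₃} = b + a₁ + a₂ + a₃`.
[cite: AtseriasDawar2019, §3.2] -/
def double (I : Instance V) : Instance (V × ZMod 2) :=
  I.bind Equation.double

variable {I : Instance V}

/-- A satisfiable instance is `c`-satisfiable for every `c ≤ 1`. [folklore] -/
theorem IsSat.isCSat (h : I.IsSat) {c : ℝ} (hc : c ≤ 1) : I.IsCSat c := by
  obtain ⟨f, hf⟩ := h
  refine ⟨f, ?_⟩
  have : I.satCount f = Multiset.card I := by
    unfold satCount
    rw [Multiset.countP_eq_card]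
    exact hf
  rw [this]
  nlinarith [Nat.cast_nonneg (α := ℝ) (Multiset.card I)]

/-- `c`-satisfiability is monotone in `c`. [folklore] -/
theorem IsCSat.mono {c c' : ℝ} (h : I.IsCSat c') (hcc' : c ≤ c') : I.IsCSat c := by
  obtain ⟨f, hf⟩ := h
  exact ⟨f, (mul_le_mul_of_nonneg_right hcc' (Nat.cast_nonneg _)).trans hf⟩

/-- Membership in the homogeneous companion. [cite: AtseriasDawar2019, §3.2] -/
theorem mem_homog {x y z : V} {b : ZMod 2} :
    (x, y, z, b) ∈ I.homog ↔ b = 0 ∧ ∃ b' : ZMod 2, (x, y, z, b') ∈ I := by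
  simp only [homog, Multiset.mem_map, Prod.mk.injEq, Prod.exists]
  constructor
  · rintro ⟨x', y', z', b', h, rfl, rfl, rfl, hb⟩
    exact ⟨hb.symm, b', h⟩
  · rintro ⟨rfl, b', h⟩
    exact ⟨x, y, z, b', h, rfl, rfl, rfl, rfl⟩

/-- `I⁰` has as many equations as `I`. [cite: AtseriasDawar2019, §3.2] -/
@[simp] theorem card_homog : Multiset.card I.homog = Multiset.card I := by
  simp [homog]

/-- Membership in `G(I)`: `x^{a₁} + y^{a₂} + z^{a₃} = b` is an equation of `G(I)` iff
`x + y + z = b + a₁ + a₂ + a₃` is an equation of `I`. [cite: AtseriasDawar2019, §3.2] -/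
theorem mem_double {x y z : V × ZMod 2} {b : ZMod 2} :
    (x, y, z, b) ∈ I.double ↔ (x.1, y.1, z.1, b + x.2 + y.2 + z.2) ∈ I := by
  obtain ⟨x, a₁⟩ := x
  obtain ⟨y, a₂⟩ := y
  obtain ⟨z, a₃⟩ := z
  simp only [double, Multiset.mem_bind, Equation.double, Multiset.mem_map, Finset.mem_val,
    Finset.mem_univ, true_and, Prod.mk.injEq, Prod.exists]
  constructor
  · rintro ⟨x', y', z', b', h, c₁, c₂, c₃, ⟨rfl, rfl⟩, ⟨rfl, rfl⟩, ⟨rfl, rfl⟩, rfl⟩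
    convert h using 4
    linear_combination (c₁ + c₂ + c₃) * CharTwo.two_eq_zero (R := ZMod 2)
  · intro h
    refine ⟨x, y, z, _, h, a₁, a₂, a₃, ⟨rfl, rfl⟩, ⟨rfl, rfl⟩, ⟨rfl, rfl⟩, ?_⟩
    linear_combination (a₁ + a₂ + a₃) * CharTwo.two_eq_zero (R := ZMod 2)

/-- `G(I)` has eight equations for each equation of `I`. [cite: AtseriasDawar2019, §3.2] -/
@[simp] theorem card_double : Multiset.card I.double = 8 * Multiset.card I := by
  induction I using Multiset.induction_on with
  | empty => simp [double]
  | cons e I ih =>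
    simp only [double] at ih
    simp only [double, Multiset.cons_bind, Multiset.card_add, Equation.card_double, ih,
      Multiset.card_cons]
    omega

/-- The homogeneous companion of a well-formed instance is well formed. [folklore] -/
theorem WellFormed.homog (h : I.WellFormed) : I.homog.WellFormed := by
  rintro ⟨x, y, z, b⟩ he
  rw [mem_homog] at he
  obtain ⟨-, b', hb'⟩ := he
  obtain ⟨h1, h2, h3⟩ := h _ hb'
  exact ⟨h1, h2, h3⟩

/-- The doubling of a well-formed instance is well formed (distinct base variables give distinct
copies). [folklore] -/
theorem WellFormed.double (h : I.WellFormed) : I.double.WellFormed := by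
  rintro ⟨x, y, z, b⟩ he
  rw [mem_double] at he
  obtain ⟨h1, h2, h3⟩ := h _ he
  exact ⟨fun hxy => h1 (congrArg Prod.fst hxy), fun hxz => h2 (congrArg Prod.fst hxz),
    fun hyz => h3 (congrArg Prod.fst hyz)⟩

/-- AD19 Lemma 3(1) at `c = 1`: if `I` is satisfiable then so is `G(I)` (set `g(x^a) = h(x) + a`).
[cite: AtseriasDawar2019, Lemma 3(1) (lem:both-lift)] -/
theorem IsSat.double (h : I.IsSat) : I.double.IsSat := by
  obtain ⟨f, hf⟩ := h
  refine ⟨fun xa => f xa.1 + xa.2, ?_⟩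
  rintro ⟨x, y, z, b⟩ he
  rw [mem_double] at he
  have := hf _ he
  simp only [Equation.IsSatBy] at this ⊢
  linear_combination this + (x.2 + y.2 + z.2) * CharTwo.two_eq_zero (R := ZMod 2)

/-- The homogeneous companion is satisfiable (by the zero assignment). [folklore] -/
theorem isSat_homog : I.homog.IsSat := by
  refine ⟨fun _ => 0, ?_⟩
  rintro ⟨x, y, z, b⟩ he
  rw [mem_homog] at he
  obtain ⟨rfl, -⟩ := he
  simp [Equation.IsSatBy]

/-- `G(I⁰)` is satisfiable for every `I` ("by setting each variable `x_j^a` to `a`"; here via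
`IsSat.double`). [cite: AtseriasDawar2019, §3.2] -/
theorem isSat_homog_double : I.homog.double.IsSat :=
  isSat_homog.double

end Instance

/-! ### The bijective `k`-pebble game on two 3XOR structures -/

/-- A position `p ⊆ V(I) × V(J)` is a PARTIAL ISOMORPHISM between the encoding structures of `I`
and `J`: it is a partial bijection and preserves each `R_b` and its negation on pebbled triples.
[cite: AtseriasDawar2019, §2.1 (partial isomorphism in the bijective game)] -/
structure IsPartialIso (I : Instance α) (J : Instance β) (p : Set (α × β)) : Prop where
  /-- `p` is a partial bijection. -/
  eq_iff : ∀ ⦃x : α × β⦄, x ∈ p → ∀ ⦃y : α × β⦄, y ∈ p → (x.1 = y.1 ↔ x.2 = y.2)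
  /-- `p` preserves the relations `R_b` and their negations. -/
  rel_iff : ∀ ⦃x : α × β⦄, x ∈ p → ∀ ⦃y : α × β⦄, y ∈ p → ∀ ⦃z : α × β⦄, z ∈ p →
    ∀ b : ZMod 2, (I.Rel b x.1 y.1 z.1 ↔ J.Rel b x.2 y.2 z.2)

namespace IsPartialIso

variable {I : Instance α} {J : Instance β} {p q : Set (α × β)}

/-- The empty position is a partial isomorphism. [folklore] -/
theorem empty (I : Instance α) (J : Instance β) : IsPartialIso I J ∅ :=
  ⟨fun x hx => (Set.notMem_empty x hx).elim, fun x hx => (Set.notMem_empty x hx).elim⟩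

/-- Sub-positions of partial isomorphisms are partial isomorphisms. [folklore] -/
theorem mono (h : IsPartialIso I J p) (hqp : q ⊆ p) : IsPartialIso I J q :=
  ⟨fun _ hx _ hy => h.eq_iff (hqp hx) (hqp hy),
    fun _ hx _ hy _ hz b => h.rel_iff (hqp hx) (hqp hy) (hqp hz) b⟩

/-- Reversing all pairs. [folklore] -/
theorem swap (h : IsPartialIso I J p) : IsPartialIso J I (Prod.swap ⁻¹' p) :=
  ⟨fun _ hx _ hy => (h.eq_iff hx hy).symm, fun _ hx _ hy _ hz b => (h.rel_iff hx hy hz b).symm⟩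

end IsPartialIso

/-- A winning strategy for Duplicator in the BIJECTIVE `k`-PEBBLE GAME on the encoding
structures of `I` and `J` (Hella 1996), as a back-and-forth system exactly as in
`Literature.ModelTheory.FiniteModelTheory.BijPebbleStrategy` (graphs): a family of finite
partial isomorphisms with at most `k` pairs, containing `∅`, closed under sub-positions, with
the bijective forth property (`|p| < k` ⇒ some bijection `f` has `p ∪ {(a, f a)}` winning for all
`a`). [cite: AtseriasDawar2019, §2.1 (k-pebble bijective game, [Hel96])] -/
structure BijPebbleStrategy (k : ℕ) (I : Instance α) (J : Instance β) where
  /-- The family of winning positions. -/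
  carrier : Set (Set (α × β))
  /-- The empty position is winning. -/
  empty_mem : ∅ ∈ carrier
  /-- Positions are finite … -/
  finite_of_mem : ∀ ⦃p : Set (α × β)⦄, p ∈ carrier → p.Finite
  /-- … have at most `k` pairs … -/
  ncard_le_of_mem : ∀ ⦃p : Set (α × β)⦄, p ∈ carrier → p.ncard ≤ k
  /-- … and are partial isomorphisms. -/
  isPartialIso_of_mem : ∀ ⦃p : Set (α × β)⦄, p ∈ carrier → IsPartialIso I J p
  /-- Closure under lifting pebble pairs. -/
  mem_of_subset : ∀ ⦃p : Set (α × β)⦄, p ∈ carrier → ∀ ⦃q : Set (α × β)⦄, q ⊆ p → q ∈ carrier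
  /-- The bijective forth property. -/
  forth : ∀ ⦃p : Set (α × β)⦄, p ∈ carrier → p.ncard < k →
    ∃ f : α ≃ β, ∀ a : α, insert (a, f a) p ∈ carrier

/-- `I ≡_{C^k} J` for 3XOR instances: Duplicator wins the bijective `k`-pebble game on their
encoding structures (equivalently, no sentence of `k`-variable counting logic `C^k` tells the
two structures apart — Hella's theorem, [Hel96] as quoted in AD19 §2.1; the game form is the
definition here). [cite: AtseriasDawar2019, §2.1] -/
def CkEquiv (k : ℕ) (I : Instance α) (J : Instance β) : Prop :=
  Nonempty (BijPebbleStrategy k I J)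

namespace CkEquiv

variable {I : Instance α} {J : Instance β} {k j : ℕ}

/-- With no pebbles Duplicator wins trivially. [folklore] -/
theorem zero (I : Instance α) (J : Instance β) : CkEquiv 0 I J :=
  ⟨{ carrier := {∅}
     empty_mem := rfl
     finite_of_mem := fun p hp => by
       rw [Set.mem_singleton_iff.1 hp]; exact Set.finite_empty
     ncard_le_of_mem := fun p hp => by rw [Set.mem_singleton_iff.1 hp, Set.ncard_empty]
     isPartialIso_of_mem := fun p hp => by
       rw [Set.mem_singleton_iff.1 hp]; exact IsPartialIso.empty I J
     mem_of_subset := fun p hp q hq => by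
       rw [Set.mem_singleton_iff.1 hp] at hq
       exact Set.mem_singleton_iff.2 (Set.subset_empty_iff.1 hq)
     forth := fun p _ hp => (Nat.not_lt_zero _ hp).elim }⟩

/-- Fewer pebbles are easier for Duplicator. [folklore] -/
theorem mono (h : CkEquiv k I J) (hjk : j ≤ k) : CkEquiv j I J := by
  obtain ⟨S⟩ := h
  exact ⟨
    { carrier := {p | p ∈ S.carrier ∧ p.ncard ≤ j}
      empty_mem := ⟨S.empty_mem, by simp⟩
      finite_of_mem := fun p hp => S.finite_of_mem hp.1
      ncard_le_of_mem := fun p hp => hp.2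
      isPartialIso_of_mem := fun p hp => S.isPartialIso_of_mem hp.1
      mem_of_subset := fun p hp q hq =>
        ⟨S.mem_of_subset hp.1 hq, (Set.ncard_le_ncard hq (S.finite_of_mem hp.1)).trans hp.2⟩
      forth := fun p hp hpj => by
        obtain ⟨f, hf⟩ := S.forth hp.1 (lt_of_lt_of_le hpj hjk)
        exact ⟨f, fun a => ⟨hf a, (Set.ncard_insert_le _ _).trans (Nat.succ_le_of_lt hpj)⟩⟩ }⟩

/-- `≡_{C^k}` is symmetric: reverse every position and invert the announced bijections.
[folklore] -/
theorem symm (h : CkEquiv k I J) : CkEquiv k J I := by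
  obtain ⟨S⟩ := h
  have hnc : ∀ q : Set (β × α), (Prod.swap ⁻¹' q).ncard = q.ncard := fun q => by
    rw [← congrFun Set.image_swap_eq_preimage_swap q,
      Set.ncard_image_of_injective q Prod.swap_injective]
  have hss : ∀ q : Set (β × α), Prod.swap ⁻¹' (Prod.swap ⁻¹' q) = q := fun q => by
    ext x; simp
  exact ⟨
    { carrier := {q | Prod.swap ⁻¹' q ∈ S.carrier}
      empty_mem := by
        show Prod.swap ⁻¹' (∅ : Set (β × α)) ∈ S.carrier
        rw [Set.preimage_empty]; exact S.empty_mem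
      finite_of_mem := fun q hq => (S.finite_of_mem hq).of_preimage Prod.swap_surjective
      ncard_le_of_mem := fun q hq => (hnc q) ▸ S.ncard_le_of_mem hq
      isPartialIso_of_mem := fun q hq => by
        simpa only [hss] using (S.isPartialIso_of_mem hq).swap
      mem_of_subset := fun q hq q' hq' => S.mem_of_subset hq (Set.preimage_mono hq')
      forth := fun q hq hqk => by
        obtain ⟨f, hf⟩ := S.forth hq ((hnc q).symm ▸ hqk)
        refine ⟨f.symm, fun b => ?_⟩
        have heq : Prod.swap ⁻¹' (insert (b, f.symm b) q) =
            insert (f.symm b, b) (Prod.swap ⁻¹' q) := by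
          ext ⟨x₁, x₂⟩
          simp only [Set.mem_preimage, Prod.swap_prod_mk, Set.mem_insert_iff, Prod.mk.injEq]
          tauto
        show Prod.swap ⁻¹' (insert (b, f.symm b) q) ∈ S.carrier
        rw [heq]
        simpa only [Equiv.apply_symm_apply] using hf (f.symm b) }⟩

/-- With at least one pebble pair, `C^k`-equivalent instances have variable sets in bijection.
[cite: AtseriasDawar2019, §2.1] -/
theorem nonempty_equiv (h : CkEquiv k I J) (hk : 0 < k) : Nonempty (α ≃ β) := by
  obtain ⟨S⟩ := h
  obtain ⟨f, -⟩ := S.forth S.empty_mem (by rwa [Set.ncard_empty])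
  exact ⟨f⟩

/-- `C^k`-equivalent instances (`k ≥ 1`) on finite variable sets have the same number of
variables. [cite: AtseriasDawar2019, §2.1] -/
theorem card_eq [Fintype α] [Fintype β] (h : CkEquiv k I J) (hk : 0 < k) :
    Fintype.card α = Fintype.card β := by
  obtain ⟨f⟩ := h.nonempty_equiv hk
  exact Fintype.card_congr f

end CkEquiv

/-! ### The encoding structure as an `L`-structure; agreement with `StructCkEquiv` -/

/-- The relation symbols of the vocabulary of 3XOR structures: one ternary symbol `R_b` for each
`b ∈ 𝔽₂` (and nothing else). [cite: AtseriasDawar2019, §3.1 (second encoding)] -/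
inductive xorRel : ℕ → Type
  | eq (b : ZMod 2) : xorRel 3

/-- The (relational) first-order vocabulary `{R₀, R₁}` of 3XOR structures, as a Mathlib
`FirstOrder.Language` (no function symbols; cf. `FirstOrder.Language.graph`).
[cite: AtseriasDawar2019, §3.1 (second encoding)] -/
def language : FirstOrder.Language := ⟨fun _ => Empty, xorRel⟩

/-- The vocabulary of 3XOR structures is relational. [folklore] -/
instance : language.IsRelational := fun _ => inferInstanceAs (IsEmpty Empty)

/-- The second encoding of `I` as a Mathlib `L`-STRUCTURE on `V` for `L = Xor3.language`:
`R_b` is interpreted by `I.Rel b` on the ordered triple (cf. `SimpleGraph.structure`).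
[cite: AtseriasDawar2019, §3.1 (second encoding)] -/
@[reducible] def Instance.structure (I : Instance V) : language.Structure V where
  RelMap | .eq b => fun x => I.Rel b (x 0) (x 1) (x 2)

/-- Pebbled triples of a labelled position respect the relations `R_b` of `I` and `J`.
[folklore] -/
def RelCompatible (I : Instance α) (J : Instance β) {k : ℕ} (p : PebblePosition k α β) : Prop :=
  ∀ ⦃x y z : α⦄ ⦃x' y' z' : β⦄, p.Pebbled x x' → p.Pebbled y y' → p.Pebbled z z' →
    ∀ b : ZMod 2, (I.Rel b x y z ↔ J.Rel b x' y' z')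

/-- Unfolding of `PebblePosition.IsPartialIso` for 3XOR structures: equality- and
`R_b`-compatibility of the pebbled pairs. [folklore] -/
theorem isPartialIso_xor3_iff (I : Instance α) (J : Instance β) {k : ℕ}
    (p : PebblePosition k α β) :
    @PebblePosition.IsPartialIso k α β language I.structure J.structure p ↔
      p.EqCompatible ∧ RelCompatible I J p := by
  letI := I.structure; letI := J.structure
  refine and_congr_right fun _ => ⟨fun h x y z x' y' z' hx hy hz b => ?_, fun h r R a b hab => ?_⟩
  · have := h (xorRel.eq b) ![x, y, z] ![x', y', z'] (by
      intro j
      fin_cases j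
      · exact hx
      · exact hy
      · exact hz)
    exact this
  · match r, R with
    | 3, .eq c => exact h (hab 0) (hab 1) (hab 2) c

/-- **The two presentations of the bijective `k`-pebble game agree on 3XOR structures**: the
unlabelled back-and-forth systems of `Xor3.CkEquiv` (as in the tree's graph `CkEquiv`,
Grohe–Otto 2015 §2) versus the labelled-pebble strategy spaces of the tree's `StructCkEquiv`
(Libkin 2004 Def. 11.4; Atserias–Dawar 2019 §2.1) for the `Xor3.language`-structures
`I.structure`, `J.structure`. The proof is that of `ckEquiv_iff_structCkEquiv` (graphs) with
adjacency replaced by the ternary relations: (→) a labelled position is winning when its set of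
pairs is, and lifting pair `i` leaves `< k` pairs so the forth property supplies the bijection;
(←) an unlabelled position is winning when it has `≤ k` pairs and is covered by the pairs of a
winning labelled position, and with `< k` pairs some pebble is free to move. [folklore] -/
theorem ckEquiv_iff_structCkEquiv {k : ℕ} (I : Instance α) (J : Instance β) :
    CkEquiv k I J ↔ @StructCkEquiv language k α β I.structure J.structure := by
  classical
  constructor
  · rintro ⟨T⟩
    refine ⟨{ positions := {p | p.pairs ∈ T.carrier}, empty_mem := ?_, move := ?_ }, ?_⟩
    · show PebblePosition.empty.pairs ∈ T.carrier
      rw [PebblePosition.pairs_empty]; exact T.empty_mem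
    · intro p hp i
      have hq : PebblePosition.pairs (Function.update p i none) ∈ T.carrier :=
        T.mem_of_subset hp (p.pairs_update_none_subset i)
      obtain ⟨f, hf⟩ := T.forth hq (p.ncard_pairs_update_none_lt i)
      refine ⟨f, fun a => ?_⟩
      show PebblePosition.pairs (Function.update p i (some (a, f a))) ∈ T.carrier
      rw [PebblePosition.pairs_update]
      exact hf a
    · intro p hp
      rw [isPartialIso_xor3_iff]
      have hP := T.isPartialIso_of_mem hp
      exact ⟨fun a a' b b' hab ha'b' => hP.eq_iff (x := (a, b)) (y := (a', b')) hab ha'b',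
        fun x y z x' y' z' hx hy hz b =>
          hP.rel_iff (x := (x, x')) (y := (y, y')) (z := (z, z')) hx hy hz b⟩
  · rintro ⟨S, hS⟩
    have hS' : ∀ ⦃p⦄, p ∈ S.positions → p.EqCompatible ∧ RelCompatible I J p := fun p hp =>
      (isPartialIso_xor3_iff I J p).1 (hS hp)
    refine ⟨{ carrier := {q | q.ncard ≤ k ∧ ∃ p ∈ S.positions, q ⊆ p.pairs}
              empty_mem := ⟨by simp, PebblePosition.empty, S.empty_mem, Set.empty_subset _⟩
              finite_of_mem := fun q ⟨_, p, _, hqp⟩ => (p.pairs_finite).subset hqp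
              ncard_le_of_mem := fun q hq => hq.1
              isPartialIso_of_mem := ?_
              mem_of_subset := fun q ⟨hqk, p, hp, hqp⟩ q' hq' =>
                ⟨(Set.ncard_le_ncard hq' ((p.pairs_finite).subset hqp)).trans hqk, p, hp,
                  hq'.trans hqp⟩
              forth := ?_ }⟩
    · rintro q ⟨-, p, hp, hqp⟩
      obtain ⟨h1, h2⟩ := hS' hp
      exact ⟨fun x hx y hy => h1 (hqp hx) (hqp hy),
        fun x hx y hy z hz b => h2 (hqp hx) (hqp hy) (hqp hz) b⟩
    · rintro q ⟨hqk, p, hp, hqp⟩ hqlt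
      have hfin : q.Finite := (p.pairs_finite).subset hqp
      -- an injective choice of a covering pebble for every pair of `q`
      have hw : ∀ x ∈ q, ∃ j : Fin k, p j = some x := fun x hx => hqp hx
      haveI : Nonempty (Fin k) := ⟨⟨0, by omega⟩⟩
      choose! wit hwit using hw
      have hinj : Set.InjOn wit q := fun x hx y hy hxy =>
        Option.some_injective _ ((hwit x hx).symm.trans (hxy ▸ hwit y hy))
      -- some pebble `i` is not used
      obtain ⟨i, hi⟩ : ∃ i : Fin k, i ∉ wit '' q := by
        by_contra hall
        push Not at hall
        have huniv : wit '' q = Set.univ := Set.eq_univ_iff_forall.2 hall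
        have h1 : (wit '' q).ncard = q.ncard := hinj.ncard_image
        have h2 : (Set.univ : Set (Fin k)).ncard = k := by rw [Set.ncard_univ, Nat.card_fin]
        rw [huniv, h2] at h1
        omega
      obtain ⟨f, hf⟩ := S.move hp i
      refine ⟨f, fun a => ⟨(Set.ncard_insert_le _ _).trans (by omega), _, hf a, ?_⟩⟩
      rw [PebblePosition.pairs_update]
      refine Set.insert_subset_insert fun x hx => ⟨wit x, ?_⟩
      have hne : wit x ≠ i := fun h => hi ⟨x, hx, h⟩
      rw [Function.update_of_ne hne]
      exact hwit x hx

/-! ### The existential `k`-pebble game against `Γ_3XOR`: local satisfiability -/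

/-- A winning strategy for Duplicator in the EXISTENTIAL `k`-PEBBLE GAME (Kolaitis–Vardi) on the
encoding structure of `I` and the template `Γ_3XOR` (universe `𝔽₂`, `R_b = {(u,v,w) | u+v+w=b}`),
second encoding: a nonempty family of PARTIAL ASSIGNMENTS — recorded as a set `D` of at most `k`
pebbled variables together with values `f` (only `f|_D` matters) — each a partial homomorphism
(every equation of `I` whose three variables are pebbled is satisfied), closed under un-pebbling,
with the forth property: if fewer than `k` variables are pebbled, any further variable `v` can be
pebbled and given a value, keeping the values on `D`. [cite: AtseriasDawar2019, §3.1 (k-locally satisfiable) and §2.1 (existential k-pebble game)] -/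
structure LocalSatStrategy (k : ℕ) (I : Instance V) where
  /-- The family of winning positions `(D, f)`. -/
  carrier : Set (Set V × (V → ZMod 2))
  /-- Some position with no pebbles is winning. -/
  empty_mem : ∃ f : V → ZMod 2, ((∅ : Set V), f) ∈ carrier
  /-- Pebbled sets are finite … -/
  finite_of_mem : ∀ ⦃D : Set V⦄ ⦃f : V → ZMod 2⦄, (D, f) ∈ carrier → D.Finite
  /-- … of size at most `k`. -/
  ncard_le_of_mem : ∀ ⦃D : Set V⦄ ⦃f : V → ZMod 2⦄, (D, f) ∈ carrier → D.ncard ≤ k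
  /-- Positions are partial homomorphisms to `Γ_3XOR`. -/
  isSatBy_of_mem : ∀ ⦃D : Set V⦄ ⦃f : V → ZMod 2⦄, (D, f) ∈ carrier → ∀ ⦃e : Equation V⦄,
    e ∈ I → e.1 ∈ D → e.2.1 ∈ D → e.2.2.1 ∈ D → e.IsSatBy f
  /-- Closure under lifting pebbles. -/
  mem_of_subset : ∀ ⦃D : Set V⦄ ⦃f : V → ZMod 2⦄, (D, f) ∈ carrier → ∀ ⦃D' : Set V⦄, D' ⊆ D →
    (D', f) ∈ carrier
  /-- The forth (extension) property. -/
  forth : ∀ ⦃D : Set V⦄ ⦃f : V → ZMod 2⦄, (D, f) ∈ carrier → D.ncard < k → ∀ v : V,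
    ∃ f' : V → ZMod 2, (∀ w ∈ D, f' w = f w) ∧ (insert v D, f') ∈ carrier

/-- `I` is `k`-LOCALLY SATISFIABLE: Duplicator wins the existential `k`-pebble game on `I` and
`Γ_3XOR` ("every set of less than `k` variables induces a satisfiable subformula and … at least
one of the satisfying assignments … can be extended to any other variable …").
[cite: AtseriasDawar2019, §3.1 (k-locally satisfiable)] -/
def Instance.IsLocallySat (k : ℕ) (I : Instance V) : Prop :=
  Nonempty (LocalSatStrategy k I)

/-- A satisfiable instance is `k`-locally satisfiable for every `k`: Duplicator answers every
pebble with the value of one fixed satisfying assignment. [folklore] -/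
theorem Instance.IsSat.isLocallySat {I : Instance V} (h : I.IsSat) (k : ℕ) :
    I.IsLocallySat k := by
  obtain ⟨f₀, hf₀⟩ := h
  exact ⟨{ carrier := {Df | Df.1.Finite ∧ Df.1.ncard ≤ k ∧ ∀ v ∈ Df.1, Df.2 v = f₀ v}
           empty_mem := ⟨f₀, Set.finite_empty, by simp, fun v hv => (Set.notMem_empty v hv).elim⟩
           finite_of_mem := fun D f hDf => hDf.1
           ncard_le_of_mem := fun D f hDf => hDf.2.1
           isSatBy_of_mem := fun D f hDf e he h1 h2 h3 => by
             have hv : ∀ v ∈ D, f v = f₀ v := hDf.2.2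
             have := hf₀ e he
             simp only [Equation.IsSatBy] at this ⊢
             rw [hv _ h1, hv _ h2, hv _ h3]
             exact this
           mem_of_subset := fun D f hDf D' hD' =>
             ⟨hDf.1.subset hD', (Set.ncard_le_ncard hD' hDf.1).trans hDf.2.1,
               fun v hv => hDf.2.2 v (hD' hv)⟩
           forth := fun D f hDf hDk v =>
             ⟨f₀, fun w hw => (hDf.2.2 w hw).symm, hDf.1.insert v,
               (Set.ncard_insert_le _ _).trans (Nat.succ_le_of_lt hDk), fun w _ => rfl⟩ }⟩

namespace Instance.IsLocallySat

variable {k : ℕ} {I : Instance V}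

/-- If all variables fit under the pebbles (`|V| ≤ k`), a `k`-locally satisfiable instance is
satisfiable: pebble the variables one at a time. [folklore] -/
theorem isSat [Finite V] (h : I.IsLocallySat k) (hk : Nat.card V ≤ k) : I.IsSat := by
  obtain ⟨S⟩ := h
  have key : ∀ n : ℕ, n ≤ Nat.card V →
      ∃ (D : Set V) (f : V → ZMod 2), (D, f) ∈ S.carrier ∧ D.ncard = n := by
    intro n
    induction n with
    | zero =>
      intro _
      obtain ⟨f, hf⟩ := S.empty_mem
      exact ⟨∅, f, hf, Set.ncard_empty _⟩
    | succ n ih =>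
      intro hn
      obtain ⟨D, f, hDf, hD⟩ := ih (Nat.le_of_succ_le hn)
      have hne : D ≠ Set.univ := by
        rintro rfl
        rw [Set.ncard_univ] at hD
        omega
      obtain ⟨a, ha⟩ := (Set.ne_univ_iff_exists_notMem D).1 hne
      obtain ⟨f', -, hf'⟩ := S.forth hDf (by omega) a
      exact ⟨insert a D, f', hf', by rw [Set.ncard_insert_of_notMem ha (Set.toFinite D), hD]⟩
  obtain ⟨D, f, hDf, hD⟩ := key (Nat.card V) le_rfl
  have hDu : D = Set.univ :=
    Set.eq_of_subset_of_ncard_le (Set.subset_univ D) (by rw [Set.ncard_univ, hD])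
      Set.finite_univ
  subst hDu
  exact ⟨f, fun e he => S.isSatBy_of_mem hDf he (Set.mem_univ _) (Set.mem_univ _)
    (Set.mem_univ _)⟩

/-- An UNSATISFIABLE `k`-locally satisfiable instance has more than `k` variables. [folklore] -/
theorem card_lt [Finite V] (h : I.IsLocallySat k) (hI : ¬ I.IsSat) : k < Nat.card V :=
  lt_of_not_ge fun hk => hI (h.isSat hk)

/-- Fewer pebbles are easier: `k`-local satisfiability implies `j`-local satisfiability for
`j ≤ k`. [folklore] -/
theorem mono {j : ℕ} (h : I.IsLocallySat k) (hjk : j ≤ k) : I.IsLocallySat j := by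
  obtain ⟨S⟩ := h
  exact ⟨
    { carrier := {Df | Df ∈ S.carrier ∧ Df.1.ncard ≤ j}
      empty_mem := by
        obtain ⟨f, hf⟩ := S.empty_mem
        exact ⟨f, hf, by simp⟩
      finite_of_mem := fun D f hDf => S.finite_of_mem hDf.1
      ncard_le_of_mem := fun D f hDf => hDf.2
      isSatBy_of_mem := fun D f hDf => S.isSatBy_of_mem hDf.1
      mem_of_subset := fun D f hDf D' hD' =>
        ⟨S.mem_of_subset hDf.1 hD', (Set.ncard_le_ncard hD' (S.finite_of_mem hDf.1)).trans hDf.2⟩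
      forth := fun D f hDf hDj v => by
        obtain ⟨f', hf', hmem⟩ := S.forth hDf.1 (lt_of_lt_of_le hDj hjk) v
        exact ⟨f', hf', hmem, (Set.ncard_insert_le _ _).trans (Nat.succ_le_of_lt hDj)⟩ }⟩

/-! ### AD19 Lemma 2: `G(I) ≡_{C^k} G(I⁰)` for `k`-locally satisfiable `I` -/

/-- **Atserias–Dawar 2019, Lemma 2.** If the 3XOR instance `I` is `k`-locally satisfiable then
its doubling `G(I)` and the doubling `G(I⁰)` of its homogeneous companion are
`C^k`-equivalent. Duplicator's bijective strategy (the printed proof): a position pebbling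
`x^{a}` in `G(I)` against `x^{a + v}` in `G(I⁰)`, where `x ↦ v` is a winning position of her
existential strategy on the pebbled variables, is winning; she announces the bijection
`x^a ↦ x^{a + f(x)}` assembled from her existential answers `f(x)` for every variable `x`.
(The printed hypothesis `k ≥ 3` is not used.) [cite: AtseriasDawar2019, Lemma 2 (lem:CFI)] -/
theorem ckEquiv_double (h : I.IsLocallySat k) : CkEquiv k I.double I.homog.double := by
  obtain ⟨S⟩ := h
  -- the variable of `I` under the left pebble of a pair
  let π : (V × ZMod 2) × (V × ZMod 2) → V := fun x => x.1.1
  refine ⟨{ carrier := {p | p.Finite ∧ p.ncard ≤ k ∧ ∃ f : V → ZMod 2, (π '' p, f) ∈ S.carrier ∧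
              ∀ x ∈ p, x.2 = (x.1.1, x.1.2 + f x.1.1)}
            empty_mem := ?_
            finite_of_mem := fun p hp => hp.1
            ncard_le_of_mem := fun p hp => hp.2.1
            isPartialIso_of_mem := ?_
            mem_of_subset := ?_
            forth := ?_ }⟩
  · obtain ⟨f, hf⟩ := S.empty_mem
    exact ⟨Set.finite_empty, by simp, f, by simpa using hf, fun x hx => (Set.notMem_empty x hx).elim⟩
  · rintro p ⟨-, -, f, hf, hp⟩
    have hsat : ∀ {x y z : (V × ZMod 2) × (V × ZMod 2)}, x ∈ p → y ∈ p → z ∈ p →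
        ∀ {b : ZMod 2}, (x.1.1, y.1.1, z.1.1, b) ∈ I → f x.1.1 + f y.1.1 + f z.1.1 = b :=
      fun hx hy hz _ hb => S.isSatBy_of_mem hf hb (Set.mem_image_of_mem π hx)
        (Set.mem_image_of_mem π hy) (Set.mem_image_of_mem π hz)
    refine ⟨fun x hx y hy => ?_, fun x hx y hy z hz b => ?_⟩
    · rw [hp x hx, hp y hy]
      constructor
      · intro hxy
        rw [hxy]
      · intro hxy
        simp only [Prod.mk.injEq] at hxy
        obtain ⟨h1, h2⟩ := hxy
        rw [h1] at h2
        exact Prod.ext h1 (add_right_cancel h2)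
    · rw [hp x hx, hp y hy, hp z hz]
      simp only [Instance.Rel, Instance.mem_double, Instance.mem_homog]
      constructor
      · intro hb
        have hs := hsat hx hy hz hb
        refine ⟨?_, _, hb⟩
        linear_combination hs + (b + x.1.2 + y.1.2 + z.1.2) * CharTwo.two_eq_zero (R := ZMod 2)
      · rintro ⟨h0, b', hb'⟩
        have hs := hsat hx hy hz hb'
        have hbb : b + x.1.2 + y.1.2 + z.1.2 = b' := by
          linear_combination h0 - hs - b' * CharTwo.two_eq_zero (R := ZMod 2)
        rw [hbb]
        exact hb'
  · rintro p ⟨hfin, hcard, f, hf, hp⟩ q hq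
    exact ⟨hfin.subset hq, (Set.ncard_le_ncard hq hfin).trans hcard, f,
      S.mem_of_subset hf (Set.image_mono hq), fun x hx => hp x (hq hx)⟩
  · rintro p ⟨hfin, hcard, f, hf, hp⟩ hpk
    have hDk : (π '' p).ncard < k := (Set.ncard_image_le hfin).trans_lt hpk
    choose g hg using fun v => S.forth hf hDk v
    refine ⟨Equiv.prodShear (Equiv.refl V) (fun v => Equiv.addRight (g v v)), ?_⟩
    rintro ⟨v, a⟩
    refine ⟨hfin.insert _, (Set.ncard_insert_le _ _).trans (Nat.succ_le_of_lt hpk), g v, ?_, ?_⟩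
    · rw [Set.image_insert_eq]
      exact (hg v).2
    · rintro x (rfl | hx)
      · simp [Equiv.prodShear]
      · rw [hp x hx, (hg v).1 _ (Set.mem_image_of_mem π hx)]

/-- Lemma 2 in the orientation of Theorem 8: `G(I⁰) ≡_{C^k} G(I)`.
[cite: AtseriasDawar2019, Lemma 2 (lem:CFI)] -/
theorem ckEquiv_homog_double (h : I.IsLocallySat k) : CkEquiv k I.homog.double I.double :=
  h.ckEquiv_double.symm

end Instance.IsLocallySat

end Xor3

/-! ### The named fact (Lemma 5 + Lemma 4) and Theorem 8 -/

/-- **The local-consistency gap for 3XOR (Atserias–Dawar 2019; NAMED FACT, not proved here).**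
For every real `ε > 0` there is a constant `c` such that for every `k ≥ 1` there is a 3XOR
instance `S_k` on `n ≤ c·k` variables with at most `c·k` equations, each on three distinct
variables, which is `k`-locally satisfiable although its doubling `G(S_k)` is not
`(1/2 + ε)`-satisfiable. This is the sentence opening the printed proof of Theorem 8 — "By
combining Lemma 5 with Lemma 4, there is a family of systems `(S_k)_{k ≥ 1}` with `O(k)`
variables and equations such that `G(S_k)` is not `(1/2+ε)`-satisfiable but `S_k` is
`k`-locally satisfiable" — where Lemma 5 (`lem:linear-local-bound`) says: for every integer
`r > 0` there is `γ > 0` such that for every large `n` some matrix `A ∈ {0,1}^{rn × n}` with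
exactly three ones per row makes `Ax = b` `k`-locally satisfiable for every `b` and every
`k ≤ γn` (bipartite unique-neighbour expanders, Ben-Sasson–Wigderson width, Atserias–Dalmau);
and Lemma 4 (`lem:both-extremal`) says: for `m = cn` with `c > 1/ε²` and `n` large, a uniformly
random `b` makes both `Ax = b` and `G(Ax = b)` at most `(1/2+ε)`-satisfiable with probability
`≥ 1 - δ` (Hoeffding + union bound). One constant serves every `k ≥ 1` (take
`n = max(n₀, ⌈k/γ⌉)`). SCOPE: only three variables per equation is asserted; the source does
not bound the number of occurrences of a variable and neither does this statement.
[cite: AtseriasDawar2019, Thm 8 (thm:3lin-onesided) proof via Lemma 5 (lem:linear-local-bound) and Lemma 4 (lem:both-extremal)] -/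
def AtseriasDawar2019_xorLocalGap : Prop :=
  ∀ ε : ℝ, 0 < ε → ∃ c : ℕ, ∀ k : ℕ, 1 ≤ k →
    ∃ (n : ℕ) (S : Xor3.Instance (Fin n)), n ≤ c * k ∧ Multiset.card S ≤ c * k ∧
      S.WellFormed ∧ S.IsLocallySat k ∧ ¬ S.double.IsCSat (1 / 2 + ε)

/-- **Atserias–Dawar 2019, Theorem 8 — the family form established in its printed proof**,
derived here from the named fact `AtseriasDawar2019_xorLocalGap` with Lemma 2 and Lemma 3(1)
(both proved above). For every `ε > 0` there is `c` such that for every `k ≥ 1` there is a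
well-formed instance `S` on `n` variables, `k < n ≤ c·k`, with at most `c·k` equations, whose
twins `I⁰ = G(S⁰)` and `I¹ = G(S)` — both on the `2n`-element variable set `Fin n × 𝔽₂`, with
`8·|S|` equations each (`card_double`) — satisfy `I⁰ ≡_{C^k} I¹`, `I⁰` satisfiable, `I¹` not
`(1/2+ε)`-satisfiable ("Let `I¹_k = G(S_k)` and `I⁰_k = G(S⁰_k)`. Then `I⁰_k ≡_{C^k} I¹_k` by
Lemma 2. Moreover … `I⁰_k` is satisfiable while … `I¹_k` is not `(1/2+ε)`-satisfiable … they
also have `O(k)` variables and equations"). The bound `k < n` is `IsLocallySat.card_lt` (`S` is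
unsatisfiable since `G(S)` is not even `min(1, 1/2+ε)`-satisfiable).
[cite: AtseriasDawar2019, Thm 8 (thm:3lin-onesided) and its proof] -/
theorem AtseriasDawar2019_thm8_family (h : AtseriasDawar2019_xorLocalGap) {ε : ℝ} (hε : 0 < ε) :
    ∃ c : ℕ, ∀ k : ℕ, 1 ≤ k → ∃ (n : ℕ) (S : Xor3.Instance (Fin n)),
      k < n ∧ n ≤ c * k ∧ Multiset.card S ≤ c * k ∧ S.WellFormed ∧
      Xor3.CkEquiv k S.homog.double S.double ∧ S.homog.double.IsSat ∧
      ¬ S.double.IsCSat (1 / 2 + ε) := by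
  -- use the fact at `ε₀ = min ε (1/2)`, so that `1/2 + ε₀ ≤ 1` forces `S` to be unsatisfiable
  obtain ⟨c, hc⟩ := h (min ε (1 / 2)) (lt_min hε one_half_pos)
  refine ⟨c, fun k hk => ?_⟩
  obtain ⟨n, S, hn, hm, hwf, hloc, hnot⟩ := hc k hk
  have hnot' : ¬ S.double.IsCSat (1 / 2 + ε) := fun hcs =>
    hnot (hcs.mono (by linarith [min_le_left ε (1 / 2)]))
  have hS : ¬ S.IsSat := fun hsat =>
    hnot (hsat.double.isCSat (by linarith [min_le_right ε (1 / 2)]))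
  have hkn : k < n := by simpa using hloc.card_lt hS
  exact ⟨n, S, hkn, hn, hm, hwf, hloc.ckEquiv_homog_double, Xor3.Instance.isSat_homog_double,
    hnot'⟩

/-- **Atserias–Dawar 2019, Theorem 8 as printed**: for every real `ε > 0`, the class of
satisfiable 3XOR instances and the class of 3XOR instances that are not `(1/2+ε)`-satisfiable
are not `C^k`-separable for any `k = k(n) = o(n)` — unfolded with the paper's definition of
separability (§2.1: two classes are `C^k`-separable when a member of one with at most `N`
elements is never `≡_{C^{k(N)}}` to a member of the other with at most `N` elements; in the
second encoding the elements are the variables) and in the slightly stronger "for all large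
`N`" form that the proof gives: for all large `N` there are, on one variable set `Fin n × 𝔽₂` of
size `2n ≤ N`, 3XOR instances (three distinct variables per equation) `I₀` satisfiable and `I₁`
not `(1/2+ε)`-satisfiable with `I₀ ≡_{C^{k(N)}} I₁`.
Derived from `AtseriasDawar2019_thm8_family` (level `max (k N) 1`, then `CkEquiv.mono`).
[cite: AtseriasDawar2019, Thm 8 (thm:3lin-onesided)] -/
theorem AtseriasDawar2019_thm8 (h : AtseriasDawar2019_xorLocalGap) {ε : ℝ} (hε : 0 < ε)
    {k : ℕ → ℕ} (hk : (fun N : ℕ => (k N : ℝ)) =o[Filter.atTop] fun N : ℕ => (N : ℝ)) :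
    ∀ᶠ N : ℕ in Filter.atTop, ∃ (n : ℕ) (I₀ I₁ : Xor3.Instance (Fin n × ZMod 2)),
      2 * n ≤ N ∧ I₀.WellFormed ∧ I₁.WellFormed ∧ I₀.IsSat ∧ ¬ I₁.IsCSat (1 / 2 + ε) ∧
        Xor3.CkEquiv (k N) I₀ I₁ := by
  obtain ⟨c, hc⟩ := AtseriasDawar2019_thm8_family h hε
  have h1 : ∀ᶠ N : ℕ in Filter.atTop, (2 * c + 1) * k N ≤ N := by
    have := (Asymptotics.isLittleO_iff_nat_mul_le.1 hk) (2 * c + 1)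
    filter_upwards [this] with N hN
    rw [Real.norm_natCast, Real.norm_natCast] at hN
    exact_mod_cast hN
  filter_upwards [h1, Filter.eventually_ge_atTop (2 * c)] with N hN hNc
  obtain ⟨n, S, -, hn, -, hwf, hequiv, hsat, hnot⟩ := hc (max (k N) 1) (le_max_right _ _)
  refine ⟨n, S.homog.double, S.double, ?_, hwf.homog.double, hwf.double, hsat, hnot,
    hequiv.mono (le_max_left _ _)⟩
  rcases Nat.eq_zero_or_pos (k N) with h0 | hpos
  · rw [h0] at hn
    simp only [Nat.zero_max, Nat.mul_one] at hn
    omega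
  · rw [max_eq_left (Nat.succ_le_of_lt hpos)] at hn
    nlinarith [hn, hN, Nat.zero_le (k N)]

end Literature.ModelTheory.FiniteModelTheory
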